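import Literature.MathematicalPhysics.QuantumFieldTheory.Balaban1983to89.BlockAveragingEMLProp1Sharp

/-!
# `Balaban1983to89.BlockAveragingEMLProp1L1` — [Balaban1985Averaging] PROPOSITION 1 IN ITS `L¹` FORM (50) FOR THE SYMMETRIC AVERAGING (0.4) OF [Balaban1987RG1]
# WITH THE PRINTED `exp[mean log]` ON `SU(N)`: the coarse plaquette of the averaged field is within the MEAN over the base points of the sizes of the translated coarse
# squares `(p′)_x` — hence of the SUMS of the fine plaquette sizes tiling them — plus second order; the one-step input of [Balaban1985UV3] (69) p.273 for the
# averaging of record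

T. Bałaban, *Averaging operations for lattice gauge theories*, Commun. Math. Phys. **98** (1985) 17–51 [Balaban1985Averaging] (cell paper B7; journal page =
PDF page + 16), Proposition 1, (50)–(51) pp. 25–26: (50) bounds `|V̄(∂p′) − 1|` by the `L^{−d}`-weighted SUM over the base points `x ∈ B(y)` of `|V((p′)_x) − 1|`
plus second order, (51) is its sup form; T. Bałaban, *Ultraviolet stability of three-dimensional lattice pure gauge field theories*, Commun. Math. Phys. **102**
(1985) 255–275 [Balaban1985UV3], (69) p. 273: *«Applying the inequalities (50), (53) [4], we have (69) |Ū_k^j(∂p′) − 1| < Σ_{x∈B^j(x₀)} L^{−3j} Σ_{p⊂(p′)_x}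
|U_k(∂p) − 1| + O(1)(g_jp(g_j))²»*; T. Bałaban, CMP **109** (1987) [Balaban1987RG1], (0.3)–(0.4) pp. 252–253, p. 253 *«valid universally for all averages …»*.

Cell `ym3-torus` (rung R3 = SU(2) YM₃ on T³ — NOT d = 4, NOT infinite volume, NOT a mass gap, NOT Clay), width seat «width 8» `ym3-torus-px8` (gen 27),
`--supports stmt-QuantumFields-20520`; HOME `UV3-NODE.md` §69.20 (4)(a): the input (69) of the per-large-plaquette small factor (71) for the averaging OF RECORD (0.4) —
the tree certifies (69)–(71) for [B7]'s own average (42)–(43) (`B10Eq69Concrete`, `B10Eq69TorusPullback`, `B10Eq71TorusLocal`) and, for (0.4), only the SUP form (51)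
(✓`BlockAveragingEMLProp2.dist1_plaqHol_avgFun_le`, cell `pub-ymgap`), which in (70)'s Cauchy–Schwarz loses a factor `L³∕2` per step.  THIS FILE gives (50)∕(69) AT ONE
STEP for (0.4) in the `L¹`-in-the-base-point form print uses.

WHAT THIS FILE PROVES (kernel, 0 `sorry`, theorems only; the private letters of ✓`BlockAveragingEMLProp2` needed here are re-proved verbatim because they are private there):
* ★★★`dist1_plaqHol_avgFun_le_of_atoms_L1` — ✓`dist1_plaqHol_avgFun_le_of_atoms` with the first-order term kept exact: `|Ū(∂p′) − 1| ≤ |J|⁻¹ Σ_J |U((p′)_{x_J}) − 1| + 143s²`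
  over the coupled index `J = (r, σ, τ, ρ, ω)` (base point `x_J = walkEnd (emb y) Γ^σ(r)`, independent of `σ` by ✓`walkEnd_stairWord_eq`, so the mean is uniform over the
  `L^d` base points of the block; the other coordinates are dummies), `s = (((d+4)L)²/4)·a`; proof = the tree's proof verbatim with ✓`coupled_first_order_le_of_atoms_sharp`
  (sibling ✓`BlockAveragingEMLProp1Sharp`) and the mean of the per-index bounds in place of their maximum.
* ★★★`dist1_plaqHol_avgFun_le_L1` — THE GLOBAL-LETTER INSTANCE WITH STOKES: if every plaquette variable of `U` is within `a` of `1` and `s ≤ δ_N/2`, then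
  `|Ū(∂p′) − 1| ≤ |J|⁻¹ Σ_J Σ_{t,s<L} |U(∂q_{J,t,s}) − 1| + 143s²`, `q_{J,t,s}` the `L²` fine plaquettes tiling `(p′)_{x_J}` (exact lattice Stokes ✓`B10Eq47AxialChi.dist1_rect_le`) —
  print's (69) at `j = 1` for (0.4), with `O(1) = 143·(((d+4)L)²/4)²`.
NOT HERE: the `j`-fold iterate (69) for `j ≥ 2` (for (0.4) the iterates do not flatten; one iterates this one-step bound with Prop. 2's window bookkeeping — a separate file),
(70)–(71) (Cauchy–Schwarz + the overlap count, as in `B10Eq70Squaring` ∕ `B10Eq71AllPlaquettes` for the concrete average).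

HONEST FRAMING.  A kernel `L¹` refinement of a landed estimate; nothing else of Bałaban's is asserted; no node of any plan is proved; the (m)_E node of `ym3-torus`'s line
(UV3-NODE §69.20) is NOT discharged by this — it names this file's statement as ONE input of its atomic letters; one finite torus at fixed lattice data — NOT continuum, NOT
infinite volume, NOT a mass gap, NOT Clay.  New sibling module; nothing in the tree is modified.
-/

noncomputable section

open scoped BigOperators

namespace Literature.MathematicalPhysics.QuantumFieldTheory.Balaban1983to89.BlockAveragingEMLProp1L1

open BlockAveragingEMLProp2 BlockAveragingEMLProp1Sharp

/-! ## §1 Second-order letters (the private letters of ✓`BlockAveragingEMLProp2` §1 needed here, re-proved verbatim) -/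

section Algebra

open ExpMeanLog MatrixLog B7BlockAvgLog NormedSpace

variable {𝔸 : Type*} [NormedRing 𝔸]

/-- `‖∏ xᵢ − 1‖ ≤ (1+b)^n − 1` for a list of `n` elements within `b` of `1`. [folklore] -/
private theorem norm_prod_sub_one_le (b : ℝ) (hb : 0 ≤ b) :
    ∀ l : List 𝔸, (∀ x ∈ l, ‖x - 1‖ ≤ b) → ‖l.prod - 1‖ ≤ (1 + b) ^ l.length - 1
  | [], _ => by simp
  | x :: l, h => by
    have hx : ‖x - 1‖ ≤ b := h x (by simp)
    have ih := norm_prod_sub_one_le b hb l fun y hy => h y (by simp [hy])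
    have hP : 0 ≤ (1 + b) ^ l.length - 1 := by
      have : (1 : ℝ) ≤ (1 + b) ^ l.length := one_le_pow₀ (by linarith)
      linarith
    rw [List.prod_cons, List.length_cons]
    have e : x * l.prod - 1 = (x - 1) * (l.prod - 1) + (x - 1) + (l.prod - 1) := by noncomm_ring
    rw [e]
    calc ‖(x - 1) * (l.prod - 1) + (x - 1) + (l.prod - 1)‖
        ≤ ‖x - 1‖ * ‖l.prod - 1‖ + ‖x - 1‖ + ‖l.prod - 1‖ :=
          (norm_add_le _ _).trans (add_le_add ((norm_add_le _ _).trans (add_le_add (norm_mul_le _ _) le_rfl)) le_rfl)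
      _ ≤ b * ((1 + b) ^ l.length - 1) + b + ((1 + b) ^ l.length - 1) := by
          gcongr
      _ = (1 + b) ^ (l.length + 1) - 1 := by ring

/-- **Products of near-`1` elements to second order**: `‖∏ xᵢ − 1 − Σ (xᵢ − 1)‖ ≤ (1+b)^n − 1 − n·b` for a list of `n`
elements within `b` of `1`. [folklore] -/
private theorem norm_prod_sub_one_sub_sum_le (b : ℝ) (hb : 0 ≤ b) :
    ∀ l : List 𝔸, (∀ x ∈ l, ‖x - 1‖ ≤ b) →
      ‖l.prod - 1 - (l.map (· - 1)).sum‖ ≤ (1 + b) ^ l.length - 1 - l.length * b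
  | [], _ => by simp
  | x :: l, h => by
    have hx : ‖x - 1‖ ≤ b := h x (by simp)
    have h' : ∀ y ∈ l, ‖y - 1‖ ≤ b := fun y hy => h y (by simp [hy])
    have ih := norm_prod_sub_one_sub_sum_le b hb l h'
    have ih₁ := norm_prod_sub_one_le b hb l h'
    have hP : 0 ≤ (1 + b) ^ l.length - 1 := by
      have : (1 : ℝ) ≤ (1 + b) ^ l.length := one_le_pow₀ (by linarith)
      linarith
    rw [List.prod_cons, List.length_cons, List.map_cons, List.sum_cons]
    have e : x * l.prod - 1 - ((x - 1) + (l.map (· - 1)).sum) =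
        (x - 1) * (l.prod - 1) + (l.prod - 1 - (l.map (· - 1)).sum) := by noncomm_ring
    rw [e]
    calc ‖(x - 1) * (l.prod - 1) + (l.prod - 1 - (l.map (· - 1)).sum)‖
        ≤ ‖x - 1‖ * ‖l.prod - 1‖ + ‖l.prod - 1 - (l.map (· - 1)).sum‖ :=
          (norm_add_le _ _).trans (add_le_add (norm_mul_le _ _) le_rfl)
      _ ≤ b * ((1 + b) ^ l.length - 1) + ((1 + b) ^ l.length - 1 - l.length * b) := by gcongr
      _ = (1 + b) ^ (l.length + 1) - 1 - ((l.length + 1 : ℕ) : ℝ) * b := by push_cast; ring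

/-- Five factors: `‖x₁x₂x₃x₄x₅ − 1 − Σ(xᵢ − 1)‖ ≤ 26b²` when every `‖xᵢ − 1‖ ≤ b ≤ 1`. [folklore] -/
private theorem norm_prod_five_sub_le {x₁ x₂ x₃ x₄ x₅ : 𝔸} {b : ℝ} (hb : 0 ≤ b) (hb1 : b ≤ 1)
    (h₁ : ‖x₁ - 1‖ ≤ b) (h₂ : ‖x₂ - 1‖ ≤ b) (h₃ : ‖x₃ - 1‖ ≤ b) (h₄ : ‖x₄ - 1‖ ≤ b) (h₅ : ‖x₅ - 1‖ ≤ b) :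
    ‖x₁ * x₂ * x₃ * x₄ * x₅ - 1 - ((x₁ - 1) + (x₂ - 1) + (x₃ - 1) + (x₄ - 1) + (x₅ - 1))‖ ≤ 26 * b ^ 2 := by
  have h := norm_prod_sub_one_sub_sum_le b hb [x₁, x₂, x₃, x₄, x₅] (by simp [h₁, h₂, h₃, h₄, h₅])
  simp only [List.prod_cons, List.prod_nil, mul_one, List.map_cons, List.map_nil, List.sum_cons, List.sum_nil,
    add_zero, List.length_cons, List.length_nil] at h
  have e : (1 + b) ^ (0 + 1 + 1 + 1 + 1 + 1) - 1 - ((0 + 1 + 1 + 1 + 1 + 1 : ℕ) : ℝ) * b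
      = b ^ 2 * (10 + 10 * b + 5 * b ^ 2 + b ^ 3) := by push_cast; ring
  rw [e] at h
  have hb' : b ^ 2 * (10 + 10 * b + 5 * b ^ 2 + b ^ 3) ≤ 26 * b ^ 2 := by
    have h26 : 10 + 10 * b + 5 * b ^ 2 + b ^ 3 ≤ 26 := by nlinarith [sq_nonneg b, mul_nonneg hb (sq_nonneg b)]
    nlinarith [sq_nonneg b]
  simpa [mul_assoc, add_assoc] using h.trans hb'


end Algebra

/-! ## §1b The mean of a family with per-index bounds -/

section Mean

variable {𝔸 : Type*} [NormedRing 𝔸] [NormedAlgebra ℂ 𝔸] {ι : Type*} [Fintype ι]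

/-- The mean of a family has norm at most the mean of any per-index norm bounds: `‖|I|⁻¹ Σ mᵢ‖ ≤ |I|⁻¹ Σ Bᵢ`. [folklore] -/
private theorem norm_mean_le_mean [Nonempty ι] {m : ι → 𝔸} {B : ι → ℝ} (h : ∀ i, ‖m i‖ ≤ B i) :
    ‖((Fintype.card ι : ℂ))⁻¹ • ∑ i, m i‖ ≤ ((Fintype.card ι : ℝ))⁻¹ * ∑ i, B i := by
  have hc : (0 : ℝ) < Fintype.card ι := Nat.cast_pos.mpr Fintype.card_pos
  have hsum : ∑ i, ‖m i‖ ≤ ∑ i, B i := Finset.sum_le_sum fun i _ => h i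
  rw [norm_smul, norm_inv, Complex.norm_natCast]
  exact mul_le_mul_of_nonneg_left ((norm_sum_le _ _).trans hsum) (inv_nonneg.mpr hc.le)

end Mean

/-! ## §2 `SU(N)` coercion letters (private in ✓`BlockAveragingEMLProp2` §2, re-proved verbatim) -/

section SUN

open T4Continuum BlockAveraging AveragingRT ExpMeanLog LatticeWordStokes B10Eq47AxialChi
open scoped Matrix.Norms.L2Operator

variable {n : Type*} [Fintype n] [DecidableEq n] [Nonempty n] {P : Params} {j : ℕ}

omit [Nonempty n] in
/-- Elements of `SU(N)` are unitary matrices. [folklore] -/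
private theorem coe_mem_unitaryGroup (g : Matrix.specialUnitaryGroup n ℂ) : (g : Matrix n n ℂ) ∈ Matrix.unitaryGroup n ℂ :=
  (Matrix.mem_specialUnitaryGroup_iff.1 g.2).1

omit [Nonempty n] in
/-- `g · g* = 1` for `g ∈ SU(N)`. [folklore] -/
private theorem coe_mul_star_self (g : Matrix.specialUnitaryGroup n ℂ) : (g : Matrix n n ℂ) * star (g : Matrix n n ℂ) = 1 :=
  Unitary.mul_star_self_of_mem (coe_mem_unitaryGroup g)

omit [Nonempty n] in
/-- The inverse in `SU(N)` is the conjugate transpose (coercion lemma). [folklore] -/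
private theorem coe_inv_eq_star (g : Matrix.specialUnitaryGroup n ℂ) :
    ((g⁻¹ : Matrix.specialUnitaryGroup n ℂ) : Matrix n n ℂ) = star (g : Matrix n n ℂ) := rfl

omit [Nonempty n] in
/-- `g*` is unitary for `g ∈ SU(N)`. [folklore] -/
private theorem star_coe_mem_unitaryGroup (g : Matrix.specialUnitaryGroup n ℂ) : star (g : Matrix n n ℂ) ∈ Matrix.unitaryGroup n ℂ :=
  coe_mem_unitaryGroup g⁻¹


end SUN

/-! ## §3 Proposition 1 in `L¹` form -/

section Main

open T4Continuum BlockAveraging AveragingRT ExpMeanLog LatticeWordStokes B10Eq47AxialChi NormedSpace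
open scoped Matrix.Norms.L2Operator

variable {n : Type*} [Fintype n] [DecidableEq n] [Nonempty n] {P : Params} {j : ℕ}

omit [Fintype n] [DecidableEq n] [Nonempty n] in
/-- The mean of a constant family is the constant. [folklore] -/
private theorem mean_const {ι : Type*} [Fintype ι] [Nonempty ι] (X : Matrix n n ℂ) :
    ((Fintype.card ι : ℂ))⁻¹ • ∑ _i : ι, X = X := by
  have hc : (Fintype.card ι : ℂ) ≠ 0 := Nat.cast_ne_zero.mpr Fintype.card_ne_zero
  rw [Finset.sum_const, Finset.card_univ, ← Nat.cast_smul_eq_nsmul ℂ, smul_smul, inv_mul_cancel₀ hc, one_smul]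

/-- ★★★ **PROPOSITION 1 FOR (0.4) IN `L¹` FORM, FROM ITS ATOMS.**  Same hypotheses as ✓`BlockAveragingEMLProp2.dist1_plaqHol_avgFun_le_of_atoms` (every atom within its
size: the loop variables at the four bonds of `∂p′`, the transport loops `Z`, the straight square, and every translated square `(p′)_x` within `L²a` — the last still needed at
SECOND order), with the FIRST-order term kept exact: `|Ū(∂p′) − 1| ≤ |J|⁻¹ Σ_J |U((p′)_{x_J}) − 1| + 143s²`, `x_J = walkEnd (emb y) Γ^σ(r)` the base point of the coupled
index `J = (r, σ, τ, ρ, ω)` (independent of `σ`: ✓`walkEnd_stairWord_eq`; so the mean is the uniform mean over the `L^d` base points `emb y + r` of the block), `s =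
(((d+4)L)²/4)·a`.  This is print's (50) p.25 «|V̄(∂p′) − 1| ≤ Σ_{x∈B(y)} L^{−d}|V((p′)_x) − 1| + O(α₀²)» for the averaging of record (0.4) — the one-step input of
[Balaban1985UV3] (69) p.273 — where the tree had only the sup form (51).  Proof = the tree's proof of `dist1_plaqHol_avgFun_le_of_atoms` verbatim with
✓`coupled_first_order_le_of_atoms_sharp` in place of `coupled_first_order_le_of_atoms` and the mean of the per-index bounds in place of their maximum.
[cite: Balaban1985Averaging, Prop. 1 (50)-(51) pp.25–26; Balaban1987RG1, (0.4) p.253] -/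
theorem dist1_plaqHol_avgFun_le_of_atoms_L1 {a : ℝ} (ha : 0 ≤ a) {U : GaugeField P j (Matrix.specialUnitaryGroup n ℂ)}
    (hs : ((((P.d + 4) * P.L : ℕ) : ℝ) ^ 2 / 4) * a ≤ deltaSU n / 2) (y : Site P (j + 1)) {μ ν : Fin P.d} (hμν : μ < ν)
    (hW₁ : ∀ i, dist1 (loopHol U ⟨y, μ⟩ i) ≤ ((((P.d + 2) * P.L : ℕ) : ℝ) ^ 2 / 4) * a)
    (hW₂ : ∀ i, dist1 (loopHol U ⟨y.shift μ, ν⟩ i) ≤ ((((P.d + 2) * P.L : ℕ) : ℝ) ^ 2 / 4) * a)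
    (hW₃ : ∀ i, dist1 (loopHol U ⟨y.shift ν, μ⟩ i) ≤ ((((P.d + 2) * P.L : ℕ) : ℝ) ^ 2 / 4) * a)
    (hW₄ : ∀ i, dist1 (loopHol U ⟨y, ν⟩ i) ≤ ((((P.d + 2) * P.L : ℕ) : ℝ) ^ 2 / 4) * a)
    (hZ : ∀ (r : Fin P.d → Fin P.L) (σ ρ : Equiv.Perm (Fin P.d)),
      dist1 (holAt U (walk (emb y) (stairWord σ (off r) ++ (List.replicate P.L (μ, true) ++ (List.replicate P.L (ν, true) ++
        (wordRev (stairWord ρ (off r)) ++ (List.replicate P.L (ν, false) ++ List.replicate P.L (μ, false)))))))) ≤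
      ((((P.d + 4) * P.L : ℕ) : ℝ) ^ 2 / 4) * a)
    (hsq : dist1 (rect U (emb y) μ ν P.L P.L) ≤ (P.L : ℝ) ^ 2 * a)
    (hsqσ : ∀ (r : Fin P.d → Fin P.L) (σ : Equiv.Perm (Fin P.d)),
      dist1 (rect U (walkEnd (emb y) (stairWord σ (off r))) μ ν P.L P.L) ≤ (P.L : ℝ) ^ 2 * a) :
    dist1 (GaugeField.plaqHol (avgFun (expMeanLogSU (n := n)) U) ⟨y, μ, ν, hμν⟩) ≤
      ((Fintype.card ((Fin P.d → Fin P.L) × Equiv.Perm (Fin P.d) × Equiv.Perm (Fin P.d) × Equiv.Perm (Fin P.d) × Equiv.Perm (Fin P.d)) : ℝ))⁻¹ *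
          ∑ J : (Fin P.d → Fin P.L) × Equiv.Perm (Fin P.d) × Equiv.Perm (Fin P.d) × Equiv.Perm (Fin P.d) × Equiv.Perm (Fin P.d),
            dist1 (rect U (walkEnd (emb y) (stairWord J.2.1 (off J.1))) μ ν P.L P.L) +
        143 * (((((P.d + 4) * P.L : ℕ) : ℝ) ^ 2 / 4) * a) ^ 2 := by
  -- constants
  set s : ℝ := ((((P.d + 4) * P.L : ℕ) : ℝ) ^ 2 / 4) * a with hs_def
  set θ : ℝ := ((((P.d + 2) * P.L : ℕ) : ℝ) ^ 2 / 4) * a with hθ_def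
  set u : ℝ := (P.L : ℝ) ^ 2 * a with hu_def
  have hδ3 : deltaSU n ≤ 1 / 3 := min_le_left _ _
  have hδ0 : 0 < deltaSU n := deltaSU_pos
  have hs0 : 0 ≤ s := by positivity
  have hθ0 : 0 ≤ θ := by positivity
  have hu0 : 0 ≤ u := by positivity
  have hs6 : s ≤ 1 / 6 := by linarith
  have hθs : θ ≤ s := by
    rw [hs_def, hθ_def]
    apply mul_le_mul_of_nonneg_right _ ha
    apply div_le_div_of_nonneg_right _ (by norm_num)
    exact_mod_cast Nat.pow_le_pow_left (Nat.mul_le_mul_right P.L (by omega : P.d + 2 ≤ P.d + 4)) 2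
  have hus : u ≤ s := by
    rw [hs_def, hu_def]
    have hd : (0 : ℝ) ≤ P.d := Nat.cast_nonneg _
    have : (P.L : ℝ) ^ 2 ≤ (((P.d + 4) * P.L : ℕ) : ℝ) ^ 2 / 4 := by
      push_cast
      nlinarith [sq_nonneg (P.L : ℝ), mul_nonneg hd (sq_nonneg (P.L : ℝ)), mul_nonneg (mul_nonneg hd hd) (sq_nonneg (P.L : ℝ))]
    exact mul_le_mul_of_nonneg_right this ha
  have hθδ : θ < deltaSU n := by linarith
  have hθ6 : θ ≤ 1 / 6 := hθs.trans hs6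
  have hθ4 : θ ≤ 1 / 4 := hθ6.trans (by norm_num)
  haveI : Nonempty (Fin P.d → Fin P.L) := ⟨fun _ => ⟨0, P.L_pos⟩⟩
  -- atoms
  set κ₁ := corr (expMeanLogSU (n := n)) U ⟨y, μ⟩
  set κ₂ := corr (expMeanLogSU (n := n)) U ⟨y.shift μ, ν⟩
  set κ₃ := corr (expMeanLogSU (n := n)) U ⟨y.shift ν, μ⟩
  set κ₄ := corr (expMeanLogSU (n := n)) U ⟨y, ν⟩
  set S₁ := axialAvg U ⟨y, μ⟩
  set S₄ := axialAvg U ⟨y, ν⟩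
  set Qp := GaugeField.plaqHol (axialAvg U) ⟨y, μ, ν, hμν⟩
  have h5 : GaugeField.plaqHol (avgFun (expMeanLogSU (n := n)) U) ⟨y, μ, ν, hμν⟩ =
      κ₁ * (S₁ * κ₂ * S₁⁻¹) * Qp * (S₄ * κ₃⁻¹ * S₄⁻¹) * κ₄⁻¹ := by
    rw [plaqHol_avgFun_eq_five, ← plaqHol_axialAvg_eq]
  rw [FederbushMean.dist1_SU_eq, h5]
  simp only [Submonoid.coe_mul, coe_inv_eq_star]
  -- the five factors are within `2s` of `1`
  have hb0 : (0 : ℝ) ≤ 2 * s := by positivity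
  have hb1 : 2 * s ≤ 1 := by linarith
  have hκ : ∀ c : PBond P (j + 1), (∀ i, dist1 (loopHol U c i) ≤ θ) →
      ‖((corr (expMeanLogSU (n := n)) U c : Matrix.specialUnitaryGroup n ℂ) : Matrix n n ℂ) - 1‖ ≤ 2 * s := fun c hWc => by
    rw [← FederbushMean.dist1_SU_eq]; exact (dist1_corr_le_two_mul U c hWc hθδ hθ6).trans (by linarith)
  have h1 : ‖((κ₁ : Matrix.specialUnitaryGroup n ℂ) : Matrix n n ℂ) - 1‖ ≤ 2 * s := hκ _ hW₁
  have h2 : ‖(S₁ : Matrix n n ℂ) * ((κ₂ : Matrix.specialUnitaryGroup n ℂ) : Matrix n n ℂ) * star (S₁ : Matrix n n ℂ) - 1‖ ≤ 2 * s := by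
    rw [norm_conj_sub_one_eq (coe_mem_unitaryGroup S₁) (star_coe_mem_unitaryGroup S₁) (coe_mul_star_self S₁)]; exact hκ _ hW₂
  have hq : ‖((Qp : Matrix.specialUnitaryGroup n ℂ) : Matrix n n ℂ) - 1‖ ≤ 2 * s := by
    rw [← FederbushMean.dist1_SU_eq, show Qp = GaugeField.plaqHol (axialAvg U) ⟨y, μ, ν, hμν⟩ from rfl, plaqHol_axialAvg_eq_rect']
    exact hsq.trans (hus.trans (by linarith))
  have h3 : ‖(S₄ : Matrix n n ℂ) * star ((κ₃ : Matrix.specialUnitaryGroup n ℂ) : Matrix n n ℂ) * star (S₄ : Matrix n n ℂ) - 1‖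
      ≤ 2 * s := by
    rw [norm_conj_sub_one_eq (coe_mem_unitaryGroup S₄) (star_coe_mem_unitaryGroup S₄) (coe_mul_star_self S₄), norm_star_sub_one]
    exact hκ _ hW₃
  have h4 : ‖star ((κ₄ : Matrix.specialUnitaryGroup n ℂ) : Matrix n n ℂ) - 1‖ ≤ 2 * s := by
    rw [norm_star_sub_one]; exact hκ _ hW₄
  have hfive := norm_prod_five_sub_le hb0 hb1 h1 h2 hq h3 h4
  -- the coupled index and the four second-order linearisations
  have m1 : ((Fintype.card ((Fin P.d → Fin P.L) × Equiv.Perm (Fin P.d) × Equiv.Perm (Fin P.d) × Equiv.Perm (Fin P.d) ×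
        Equiv.Perm (Fin P.d)) : ℂ))⁻¹ • ∑ J : (Fin P.d → Fin P.L) × Equiv.Perm (Fin P.d) × Equiv.Perm (Fin P.d) ×
        Equiv.Perm (Fin P.d) × Equiv.Perm (Fin P.d),
        ((((loopHol U ⟨y, μ⟩ (J.1, J.2.1, J.2.2.1)) : Matrix.specialUnitaryGroup n ℂ) : Matrix n n ℂ) - 1) =
      ((Fintype.card (Idx P) : ℂ))⁻¹ • ∑ i : Idx P, ((((loopHol U ⟨y, μ⟩ i) : Matrix.specialUnitaryGroup n ℂ) : Matrix n n ℂ) - 1) :=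
    mean_couple₁₂ (fun i : Idx P => ((((loopHol U ⟨y, μ⟩ i) : Matrix.specialUnitaryGroup n ℂ) : Matrix n n ℂ) - 1))
  have m2 : ((Fintype.card ((Fin P.d → Fin P.L) × Equiv.Perm (Fin P.d) × Equiv.Perm (Fin P.d) × Equiv.Perm (Fin P.d) ×
        Equiv.Perm (Fin P.d)) : ℂ))⁻¹ • ∑ J : (Fin P.d → Fin P.L) × Equiv.Perm (Fin P.d) × Equiv.Perm (Fin P.d) ×
        Equiv.Perm (Fin P.d) × Equiv.Perm (Fin P.d),
        ((S₁ : Matrix n n ℂ) * ((((loopHol U ⟨y.shift μ, ν⟩ (J.1, J.2.2.1, J.2.2.2.1)) : Matrix.specialUnitaryGroup n ℂ) :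
          Matrix n n ℂ) - 1) * star (S₁ : Matrix n n ℂ)) =
      ((Fintype.card (Idx P) : ℂ))⁻¹ • ∑ i : Idx P, ((S₁ : Matrix n n ℂ) *
        ((((loopHol U ⟨y.shift μ, ν⟩ i) : Matrix.specialUnitaryGroup n ℂ) : Matrix n n ℂ) - 1) * star (S₁ : Matrix n n ℂ)) :=
    mean_couple₂₃ (fun i : Idx P => (S₁ : Matrix n n ℂ) *
      ((((loopHol U ⟨y.shift μ, ν⟩ i) : Matrix.specialUnitaryGroup n ℂ) : Matrix n n ℂ) - 1) * star (S₁ : Matrix n n ℂ))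
  have m3 : ((Fintype.card ((Fin P.d → Fin P.L) × Equiv.Perm (Fin P.d) × Equiv.Perm (Fin P.d) × Equiv.Perm (Fin P.d) ×
        Equiv.Perm (Fin P.d)) : ℂ))⁻¹ • ∑ J : (Fin P.d → Fin P.L) × Equiv.Perm (Fin P.d) × Equiv.Perm (Fin P.d) ×
        Equiv.Perm (Fin P.d) × Equiv.Perm (Fin P.d),
        ((S₄ : Matrix n n ℂ) * (star ((((loopHol U ⟨y.shift ν, μ⟩ (J.1, J.2.2.2.2, J.2.2.2.1)) : Matrix.specialUnitaryGroup n ℂ) :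
          Matrix n n ℂ)) - 1) * star (S₄ : Matrix n n ℂ)) =
      ((Fintype.card (Idx P) : ℂ))⁻¹ • ∑ i : Idx P, ((S₄ : Matrix n n ℂ) *
        (star ((((loopHol U ⟨y.shift ν, μ⟩ i) : Matrix.specialUnitaryGroup n ℂ) : Matrix n n ℂ)) - 1) * star (S₄ : Matrix n n ℂ)) :=
    mean_couple₅₄ (fun i : Idx P => (S₄ : Matrix n n ℂ) *
      (star ((((loopHol U ⟨y.shift ν, μ⟩ i) : Matrix.specialUnitaryGroup n ℂ) : Matrix n n ℂ)) - 1) * star (S₄ : Matrix n n ℂ))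
  have m4 : ((Fintype.card ((Fin P.d → Fin P.L) × Equiv.Perm (Fin P.d) × Equiv.Perm (Fin P.d) × Equiv.Perm (Fin P.d) ×
        Equiv.Perm (Fin P.d)) : ℂ))⁻¹ • ∑ J : (Fin P.d → Fin P.L) × Equiv.Perm (Fin P.d) × Equiv.Perm (Fin P.d) ×
        Equiv.Perm (Fin P.d) × Equiv.Perm (Fin P.d),
        (star ((((loopHol U ⟨y, ν⟩ (J.1, J.2.1, J.2.2.2.2)) : Matrix.specialUnitaryGroup n ℂ) : Matrix n n ℂ)) - 1) =
      ((Fintype.card (Idx P) : ℂ))⁻¹ • ∑ i : Idx P, (star ((((loopHol U ⟨y, ν⟩ i) : Matrix.specialUnitaryGroup n ℂ) :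
        Matrix n n ℂ)) - 1) :=
    mean_couple₁₅ (fun i : Idx P => star ((((loopHol U ⟨y, ν⟩ i) : Matrix.specialUnitaryGroup n ℂ) : Matrix n n ℂ)) - 1)
  have e1 := norm_corr_sub_mean_le U ⟨y, μ⟩ hW₁ hθδ hθ4
  rw [← m1] at e1
  have e2 := norm_conj_corr_sub_mean_le U ⟨y.shift μ, ν⟩ S₁ hW₂ hθδ hθ4
  rw [← m2] at e2
  have e3 := norm_conj_corr_star_sub_mean_le U ⟨y.shift ν, μ⟩ S₄ hW₃ hθδ hθ4
  rw [← m3] at e3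
  have e4 := norm_corr_star_sub_mean_le U ⟨y, ν⟩ hW₄ hθδ hθ4
  rw [← m4] at e4
  -- the per-index estimate, averaged
  have hJ : ∀ J : (Fin P.d → Fin P.L) × Equiv.Perm (Fin P.d) × Equiv.Perm (Fin P.d) × Equiv.Perm (Fin P.d) × Equiv.Perm (Fin P.d),
      ‖((((loopHol U ⟨y, μ⟩ (J.1, J.2.1, J.2.2.1)) : Matrix.specialUnitaryGroup n ℂ) : Matrix n n ℂ) - 1) +
        ((S₁ : Matrix n n ℂ) * ((((loopHol U ⟨y.shift μ, ν⟩ (J.1, J.2.2.1, J.2.2.2.1)) : Matrix.specialUnitaryGroup n ℂ) :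
          Matrix n n ℂ) - 1) * star (S₁ : Matrix n n ℂ)) +
        ((S₄ : Matrix n n ℂ) * (star ((((loopHol U ⟨y.shift ν, μ⟩ (J.1, J.2.2.2.2, J.2.2.2.1)) : Matrix.specialUnitaryGroup n ℂ) :
          Matrix n n ℂ)) - 1) * star (S₄ : Matrix n n ℂ)) +
        (star ((((loopHol U ⟨y, ν⟩ (J.1, J.2.1, J.2.2.2.2)) : Matrix.specialUnitaryGroup n ℂ) : Matrix n n ℂ)) - 1) +
        (((Qp : Matrix.specialUnitaryGroup n ℂ) : Matrix n n ℂ) - 1)‖ ≤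
        dist1 (rect U (walkEnd (emb y) (stairWord J.2.1 (off J.1))) μ ν P.L P.L) + 15 * s ^ 2 :=
    fun J => coupled_first_order_le_of_atoms_sharp ha hs6 y hμν J.1 J.2.1 J.2.2.1 J.2.2.2.1 J.2.2.2.2 hW₁ hW₂ hW₃ hW₄ (hZ _ _ _) hsq
      (hsqσ _ _)
  have hmean := norm_mean_le_mean hJ
  simp only [Finset.sum_add_distrib, smul_add, mean_const] at hmean
  have hcard : (0 : ℝ) < Fintype.card ((Fin P.d → Fin P.L) × Equiv.Perm (Fin P.d) × Equiv.Perm (Fin P.d) × Equiv.Perm (Fin P.d) × Equiv.Perm (Fin P.d)) :=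
    Nat.cast_pos.mpr Fintype.card_pos
  rw [mul_add, Finset.sum_const, Finset.card_univ, nsmul_eq_mul, ← mul_assoc, inv_mul_cancel₀ hcard.ne', one_mul] at hmean
  have hM0 : 0 ≤ ((Fintype.card ((Fin P.d → Fin P.L) × Equiv.Perm (Fin P.d) × Equiv.Perm (Fin P.d) × Equiv.Perm (Fin P.d) × Equiv.Perm (Fin P.d)) : ℝ))⁻¹ *
      ∑ J : (Fin P.d → Fin P.L) × Equiv.Perm (Fin P.d) × Equiv.Perm (Fin P.d) × Equiv.Perm (Fin P.d) × Equiv.Perm (Fin P.d),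
        dist1 (rect U (walkEnd (emb y) (stairWord J.2.1 (off J.1))) μ ν P.L P.L) :=
    mul_nonneg (inv_nonneg.mpr hcard.le) (Finset.sum_nonneg fun J _ => GaugeGroup.dist1_nonneg _)
  -- assemble
  have etot : ∀ (x₁ x₂ q x₃ x₄ f₁ f₂ f₃ f₄ : Matrix n n ℂ), x₁ * x₂ * q * x₃ * x₄ - 1 =
      (x₁ * x₂ * q * x₃ * x₄ - 1 - ((x₁ - 1) + (x₂ - 1) + (q - 1) + (x₃ - 1) + (x₄ - 1))) +
      (((x₁ - 1) - f₁) + ((x₂ - 1) - f₂) + ((x₃ - 1) - f₃) + ((x₄ - 1) - f₄)) +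
      (f₁ + f₂ + f₃ + f₄ + (q - 1)) := fun _ _ _ _ _ _ _ _ _ => by abel
  rw [etot _ _ _ _ _
    (((Fintype.card ((Fin P.d → Fin P.L) × Equiv.Perm (Fin P.d) × Equiv.Perm (Fin P.d) × Equiv.Perm (Fin P.d) ×
        Equiv.Perm (Fin P.d)) : ℂ))⁻¹ • ∑ J : (Fin P.d → Fin P.L) × Equiv.Perm (Fin P.d) × Equiv.Perm (Fin P.d) ×
        Equiv.Perm (Fin P.d) × Equiv.Perm (Fin P.d),
        ((((loopHol U ⟨y, μ⟩ (J.1, J.2.1, J.2.2.1)) : Matrix.specialUnitaryGroup n ℂ) : Matrix n n ℂ) - 1))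
    (((Fintype.card ((Fin P.d → Fin P.L) × Equiv.Perm (Fin P.d) × Equiv.Perm (Fin P.d) × Equiv.Perm (Fin P.d) ×
        Equiv.Perm (Fin P.d)) : ℂ))⁻¹ • ∑ J : (Fin P.d → Fin P.L) × Equiv.Perm (Fin P.d) × Equiv.Perm (Fin P.d) ×
        Equiv.Perm (Fin P.d) × Equiv.Perm (Fin P.d),
        ((S₁ : Matrix n n ℂ) * ((((loopHol U ⟨y.shift μ, ν⟩ (J.1, J.2.2.1, J.2.2.2.1)) : Matrix.specialUnitaryGroup n ℂ) :
          Matrix n n ℂ) - 1) * star (S₁ : Matrix n n ℂ)))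
    (((Fintype.card ((Fin P.d → Fin P.L) × Equiv.Perm (Fin P.d) × Equiv.Perm (Fin P.d) × Equiv.Perm (Fin P.d) ×
        Equiv.Perm (Fin P.d)) : ℂ))⁻¹ • ∑ J : (Fin P.d → Fin P.L) × Equiv.Perm (Fin P.d) × Equiv.Perm (Fin P.d) ×
        Equiv.Perm (Fin P.d) × Equiv.Perm (Fin P.d),
        ((S₄ : Matrix n n ℂ) * (star ((((loopHol U ⟨y.shift ν, μ⟩ (J.1, J.2.2.2.2, J.2.2.2.1)) : Matrix.specialUnitaryGroup n ℂ) :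
          Matrix n n ℂ)) - 1) * star (S₄ : Matrix n n ℂ)))
    (((Fintype.card ((Fin P.d → Fin P.L) × Equiv.Perm (Fin P.d) × Equiv.Perm (Fin P.d) × Equiv.Perm (Fin P.d) ×
        Equiv.Perm (Fin P.d)) : ℂ))⁻¹ • ∑ J : (Fin P.d → Fin P.L) × Equiv.Perm (Fin P.d) × Equiv.Perm (Fin P.d) ×
        Equiv.Perm (Fin P.d) × Equiv.Perm (Fin P.d),
        (star ((((loopHol U ⟨y, ν⟩ (J.1, J.2.1, J.2.2.2.2)) : Matrix.specialUnitaryGroup n ℂ) : Matrix n n ℂ)) - 1))]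
  refine (norm_add_le _ _).trans ((add_le_add ((norm_add_le _ _).trans (add_le_add hfive
    ((norm_add_le _ _).trans (add_le_add ((norm_add_le _ _).trans (add_le_add ((norm_add_le _ _).trans (add_le_add e1 e2)) e3)) e4))))
    hmean).trans ?_)
  nlinarith [mul_le_mul hθs hθs hθ0 hs0]


/-- ★★★ **[Balaban1985Averaging] PROPOSITION 1 IN THE `L¹` FORM (50) ∕ [Balaban1985UV3] (69), ONE AVERAGING STEP, FOR THE SYMMETRIC AVERAGING (0.4) WITH THE
PRINTED `exp[mean log]`: `|Ū(∂p′) − 1| ≤ |J|⁻¹ Σ_J Σ_{q ⊂ (p′)_{x_J}} |U(∂q) − 1| + 143·s²`** whenever every plaquette variable of `U` is within `a` of `1` and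
`s = (((d+4)L)²/4)·a ≤ δ_N/2` — the mean over the base points `x_J = walkEnd (emb y) Γ^σ(r)` of the block (uniform over `r`, the other coordinates of the coupled index
`J = (r, σ, τ, ρ, ω)` being dummies) of the SUM of the sizes of the `L × L` fine plaquettes tiling the translated coarse square `(p′)_{x_J}` (exact lattice Stokes,
✓`B10Eq47AxialChi.dist1_rect_le`), plus second order.  Print: *«|V̄(∂p′) − 1| ≤ … (50) … Applying the inequalities (50), (53) [4], we have (69)
|Ū_k^j(∂p′) − 1| < Σ_{x∈B^j(x₀)} L^{−3j} Σ_{p⊂(p′)_x} |U_k(∂p) − 1| + O(1)(g_jp(g_j))²»* — here at `j = 1` for the averaging of record ([Balaban1987RG1] p.253: *«valid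
universally for all averages satisfying the above properties»*).  The sup form (51) `≤ L²a + 143s²` (✓`dist1_plaqHol_avgFun_le`) is the special case `|U(∂q) − 1| ≤ a`.
[cite: Balaban1985Averaging, Prop. 1 (50)-(51) pp.25–26; Balaban1985UV3, (69) p.273; Balaban1987RG1, (0.4) p.253] -/
theorem dist1_plaqHol_avgFun_le_L1 {a : ℝ} (ha : 0 ≤ a) {U : GaugeField P j (Matrix.specialUnitaryGroup n ℂ)}
    (hU : ∀ q : Plaq P j, dist1 (GaugeField.plaqHol U q) ≤ a)
    (hs : ((((P.d + 4) * P.L : ℕ) : ℝ) ^ 2 / 4) * a ≤ deltaSU n / 2) (y : Site P (j + 1)) {μ ν : Fin P.d} (hμν : μ < ν) :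
    dist1 (GaugeField.plaqHol (avgFun (expMeanLogSU (n := n)) U) ⟨y, μ, ν, hμν⟩) ≤
      ((Fintype.card ((Fin P.d → Fin P.L) × Equiv.Perm (Fin P.d) × Equiv.Perm (Fin P.d) × Equiv.Perm (Fin P.d) × Equiv.Perm (Fin P.d)) : ℝ))⁻¹ *
          ∑ J : (Fin P.d → Fin P.L) × Equiv.Perm (Fin P.d) × Equiv.Perm (Fin P.d) × Equiv.Perm (Fin P.d) × Equiv.Perm (Fin P.d),
            ∑ t ∈ Finset.range P.L, ∑ s ∈ Finset.range P.L,
              dist1 (GaugeField.plaqHol U ⟨shiftN (shiftN (walkEnd (emb y) (stairWord J.2.1 (off J.1))) ν t) μ s, μ, ν, hμν⟩) +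
        143 * (((((P.d + 4) * P.L : ℕ) : ℝ) ^ 2 / 4) * a) ^ 2 := by
  have hcard : (0 : ℝ) ≤ ((Fintype.card ((Fin P.d → Fin P.L) × Equiv.Perm (Fin P.d) × Equiv.Perm (Fin P.d) × Equiv.Perm (Fin P.d) × Equiv.Perm (Fin P.d)) : ℝ))⁻¹ := inv_nonneg.mpr (Nat.cast_nonneg _)
  refine (dist1_plaqHol_avgFun_le_of_atoms_L1 ha hs y hμν (fun i => dist1_loopHol_le' ha hU _ i) (fun i => dist1_loopHol_le' ha hU _ i)
    (fun i => dist1_loopHol_le' ha hU _ i) (fun i => dist1_loopHol_le' ha hU _ i) (fun r σ ρ => dist1_zWord_le ha hU y μ ν σ ρ r)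
    (dist1_rect_LL_le U hU (emb y) hμν) (fun r σ => dist1_rect_LL_le U hU _ hμν)).trans (add_le_add ?_ le_rfl)
  exact mul_le_mul_of_nonneg_left (Finset.sum_le_sum fun J _ => dist1_rect_le U _ hμν P.L P.L) hcard

end Main

end Literature.MathematicalPhysics.QuantumFieldTheory.Balaban1983to89.BlockAveragingEMLProp1L1

end
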